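import Mathlib
import Summits.KontsevichZagierPeriods.KontsevichZagierPeriods.Theorems.SoloInformedSecondKindWThreeFive
import HarnessLib
import HarnessLib.Audit

/-!
# Level 6 decided: the `K`-hull `K[⟦β(⅙,½)⟧, ⟦β(⅔,½)⟧]` and all 36 level-6 Beta classes (solo-informed, s24)

The closing theorem of the level-6 repertoire (paper §6octies (vi), (xi)):

* **independence** of the two generator values `B(⅙,½), B(⅔,½)` over `ℚ`
  (`soloInformed_algebraicIndependent_levelSix`; Chudnovsky on `π, Γ(⅓)` — in the tree as the
  independence of `![B(⅙,½), π]`, Theorem IX″ — transported along Euler's relation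
  `B(⅙,½)·B(⅔,½) = 6π`, itself derived by the moves);
* hence **`KZP` on the `K`-hull `H = K[⟦β(⅙,½)⟧, ⟦β(⅔,½)⟧]`** (`soloInformed_kzp_on_hull_levelSix`):
  equal values ⇒ equivalent by the Kontsevich–Zagier moves, for representations of any dimensions
  with classes in `H`;
* **every pinned level-6 Beta representation `β(i/6, j/6)`, `1 ≤ i, j ≤ 6`, has its class in `H`**
  — indeed in every `K`-hull containing the two generators (`soloInformed_betaLevelSix_mem_algHull`):
  the 36 classes are tied to the generators by the kernel-checked chains of Theorems IX‴–XIII‴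
  (unit exponent, swap, duplication, torsion `W12`, inversion, the `3`-isogeny and its second-kind
  companion W35, W45, W25, Euler's family, the reflections at `⅙, ⅓, ½`), with algebraic
  multipliers inverted inside the point field `K ⊂ P`;
* so **the period conjecture is DECIDED at level 6** (`soloInformed_kzp_betaLevelSix`): two level-6
  Beta representations with the same value are equivalent by the moves — unconditionally; more
  generally a level-6 Beta representation is equivalent to ANY representation of the same value
  whose class lies in `H` (`soloInformed_levelSix_decided`).

What is NOT decided by this file: sectors with three independent generators (e.g. adjoining
`⟦β(¼,½)⟧`: `trdeg ℚ(π, Γ(¼), Γ(⅓)) = 3` is open), paper §8.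

References: M. Kontsevich, D. Zagier, *Periods* (2001), §1.2; G. V. Chudnovsky, *Contributions to
the theory of transcendental numbers* (1984), Ch. 7; G. Andrews, R. Askey, R. Roy, *Special
Functions* (1999), §1.1, §1.5; this work (solo-informed s22–s24).
-/

noncomputable section

open MeasureTheory Set Filter
open scoped Classical

open Literature.NumberTheory.Transcendental Literature.NumberTheory.Transcendental.KZ
open Literature.ModelTheory.ExponentialFields

namespace Summit.KontsevichZagierPeriods.KontsevichZagierPeriods.Theorems

/-! ### Pinning bookkeeping -/

/-- A Beta representation `β(a,b) = [(0,1), t^{a−1}(1−t)^{b−1}]` exists for all rationals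
`a, b > 0` (pinned by domain and integrand ON the domain). [Kontsevich–Zagier 2001, §1.1] -/
theorem soloInformed_exists_betaRep (a b : ℚ) (ha : 0 < a) (hb : 0 < b) :
    ∃ B : IntegralRep 1, B.domain = {t | t 0 ∈ Ioo (0:ℝ) 1} ∧
      EqOn B.integrand (fun t => (t 0) ^ ((a : ℝ) - 1) * (1 - t 0) ^ ((b : ℝ) - 1)) B.domain := by
  obtain ⟨B, hBd, hBi⟩ := exists_betaRep' a b ha hb
  exact ⟨B, hBd, fun t _ => by rw [hBi]⟩

/-- Rewriting the two exponents of a pinning along equalities of real numbers. [folklore] -/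
theorem soloInformed_isBeta_congr {M : IntegralRep 1} {a b a' b' : ℝ}
    (hMi : EqOn M.integrand (fun t => (t 0) ^ (a - 1) * (1 - t 0) ^ (b - 1)) M.domain)
    (ha : a = a') (hb : b = b') :
    EqOn M.integrand (fun t => (t 0) ^ (a' - 1) * (1 - t 0) ^ (b' - 1)) M.domain := by
  subst ha hb
  exact hMi

/-- Two representations pinned by the same data have the same class in `P` (integrand
additivity with a zero representation). [Kontsevich–Zagier 2001, §1.2 rule (1)] -/
theorem soloInformed_beta_class_eq {M N : IntegralRep 1} {f : (Fin 1 → ℝ) → ℝ}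
    (hNd : N.domain = {t | t 0 ∈ Ioo (0:ℝ) 1}) (hNi : EqOn N.integrand f N.domain)
    (hMd : M.domain = {t | t 0 ∈ Ioo (0:ℝ) 1}) (hMi : EqOn M.integrand f M.domain) :
    toFormalPeriod (of M) = toFormalPeriod (of N) :=
  toFormalPeriod_eq_iff.2 (of_sub_of_mem_relations_of_eqOn (hNd.trans hMd.symm)
    fun t ht => (hMi ht).trans (hNi (by rw [hNd]; rw [hMd] at ht; exact ht)).symm)

/-! ### Memberships in a general `K`-hull -/

/-- **`⟦β(a,1)⟧` lies in every `K`-hull** (`β(a,1) ∼ [pt, 1/a]`, unit exponent). [this work] -/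
theorem soloInformed_betaFirst_mem_algHull (a : ℚ) (ha : 0 < a) (L : IntegralRep 1)
    (hLd : L.domain = {t | t 0 ∈ Ioo (0:ℝ) 1})
    (hLi : EqOn L.integrand
      (fun t => (t 0) ^ ((a : ℝ) - 1) * (1 - t 0) ^ (((1 : ℚ) : ℝ) - 1)) L.domain)
    {k : ℕ} (cs : Fin k → FormalPeriodRing) :
    toFormalPeriod (of L) ∈ soloInformedAlgHull cs := by
  have hainv : IsAlgebraic ℚ ((a : ℝ))⁻¹ := by
    rw [← Rat.cast_inv]; exact isAlgebraic_algebraMap _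
  rw [(betaFirst_equivalent_unit_constMul a ha L hLd hLi hainv).toFormalPeriod_eq]
  exact soloInformed_pointRep_mem_algHull cs _ hainv

/-- **`⟦β(1,a)⟧` lies in every `K`-hull** (swap, then unit exponent). [this work] -/
theorem soloInformed_betaSecond_mem_algHull (a : ℚ) (ha : 0 < a) (L : IntegralRep 1)
    (hLd : L.domain = {t | t 0 ∈ Ioo (0:ℝ) 1})
    (hLi : EqOn L.integrand
      (fun t => (t 0) ^ (((1 : ℚ) : ℝ) - 1) * (1 - t 0) ^ ((a : ℝ) - 1)) L.domain)
    {k : ℕ} (cs : Fin k → FormalPeriodRing) :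
    toFormalPeriod (of L) ∈ soloInformedAlgHull cs := by
  obtain ⟨L', hL'd, hL'i⟩ := soloInformed_exists_betaRep a 1 ha one_pos
  rw [soloInformed_beta_swap 1 a L L' hLd hLi hL'd hL'i]
  exact soloInformed_betaFirst_mem_algHull a ha L' hL'd hL'i cs

/-- **`⟦β(⅓,½)⟧` lies in the `K`-hull of any family whose hull contains `⟦β(⅙,½)⟧`**: the
`3`-isogeny chain `⟦β(⅙,½)⟧ = ⟦[pt,√3]⟧·⟦β(⅓,½)⟧` read backwards (`⟦[pt,1/√3]⟧ ∈ K`).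
[this work] -/
theorem soloInformed_betaThirdHalf_mem_algHull (B₃ B₆ : IntegralRep 1)
    (hB₃d : B₃.domain = {t | t 0 ∈ Ioo (0:ℝ) 1})
    (hB₃i : EqOn B₃.integrand
      (fun t => (t 0) ^ (((1 / 3 : ℚ) : ℝ) - 1) * (1 - t 0) ^ (((1 / 2 : ℚ) : ℝ) - 1)) B₃.domain)
    (hB₆d : B₆.domain = {t | t 0 ∈ Ioo (0:ℝ) 1})
    (hB₆i : EqOn B₆.integrand
      (fun t => (t 0) ^ (((1 / 6 : ℚ) : ℝ) - 1) * (1 - t 0) ^ (((1 / 2 : ℚ) : ℝ) - 1)) B₆.domain)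
    {k : ℕ} (cs : Fin k → FormalPeriodRing) (hB₆ : toFormalPeriod (of B₆) ∈ soloInformedAlgHull cs) :
    toFormalPeriod (of B₃) ∈ soloInformedAlgHull cs := by
  have h3 : Real.sqrt 3 ≠ 0 := by positivity
  have hinv : IsAlgebraic ℚ (Real.sqrt 3)⁻¹ := (soloInformed_isAlgebraic_sqrt_natCast 3).inv
  have hB₃ : toFormalPeriod (of B₃) = toFormalPeriod (of (IntegralRep.unit.constMul
      (Real.sqrt 3)⁻¹ hinv)) * toFormalPeriod (of B₆) := by
    rw [soloInformed_isogeny_chain B₃ B₆ hB₃d hB₃i hB₆d hB₆i, ← mul_assoc,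
      soloInformed_pointRep_inv_mul _ _ h3 hinv, one_mul]
  rw [hB₃]
  exact mul_mem (soloInformed_pointRep_mem_algHull cs _ hinv) hB₆

/-- **`⟦π⟧ = ⟦[disc,1]⟧` lies in the `K`-hull of any family whose hull contains `⟦β(⅙,½)⟧` and
`⟦β(⅔,½)⟧`**: Euler's relation `⟦β(⅙,½)⟧·⟦β(⅔,½)⟧ = 6·⟦π⟧` (derived by the moves) and
`⟦[pt,1/6]⟧ ∈ K`. [Euler E321; this work] -/
theorem soloInformed_piRep_mem_algHull (B₁₃ B₄₃ : IntegralRep 1)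
    (h13d : B₁₃.domain = {t | t 0 ∈ Ioo (0:ℝ) 1})
    (h13i : EqOn B₁₃.integrand
      (fun t => (t 0) ^ (((1 / 6 : ℚ) : ℝ) - 1) * (1 - t 0) ^ (((1 / 2 : ℚ) : ℝ) - 1)) B₁₃.domain)
    (h43d : B₄₃.domain = {t | t 0 ∈ Ioo (0:ℝ) 1})
    (h43i : EqOn B₄₃.integrand
      (fun t => (t 0) ^ (((2 / 3 : ℚ) : ℝ) - 1) * (1 - t 0) ^ (((1 / 2 : ℚ) : ℝ) - 1)) B₄₃.domain)
    {k : ℕ} (cs : Fin k → FormalPeriodRing) (h13 : toFormalPeriod (of B₁₃) ∈ soloInformedAlgHull cs)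
    (h43 : toFormalPeriod (of B₄₃) ∈ soloInformedAlgHull cs) :
    toFormalPeriod (of KZ.piRep) ∈ soloInformedAlgHull cs := by
  have hEu := soloInformed_euler_beta_family 1 6 B₁₃ B₄₃ one_pos (by norm_num) h13d
    (fun t ht => by rw [h13i ht]; norm_num) h43d (fun t ht => by rw [h43i ht]; norm_num)
  simp only [Nat.cast_one, one_mul] at hEu
  have h6 : IsAlgebraic ℚ (((6 : ℕ) : ℝ)) := isAlgebraic_nat 6
  have h6inv : IsAlgebraic ℚ (((6 : ℕ) : ℝ))⁻¹ := h6.inv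
  have hπ : toFormalPeriod (of KZ.piRep) = toFormalPeriod (of (IntegralRep.unit.constMul
      (((6 : ℕ) : ℝ))⁻¹ h6inv)) * (toFormalPeriod (of B₁₃) * toFormalPeriod (of B₄₃)) := by
    rw [hEu, ← toFormalPeriod_of_unit_constMul_natCast 6 h6, ← mul_assoc,
      soloInformed_pointRep_inv_mul _ h6 (by norm_num) h6inv, one_mul]
  rw [hπ]
  exact mul_mem (soloInformed_pointRep_mem_algHull cs _ h6inv) (mul_mem h13 h43)

/-- **`⟦β(⅓,⅔)⟧` lies in the `K`-hull of any family whose hull contains `⟦π⟧`**: the reflection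
chain `⟦[pt,√3]⟧·⟦β(⅓,⅔)⟧ = 2·⟦π⟧` of Theorem IX⁗ (IV). [this work] -/
theorem soloInformed_betaThirdTwoThirds_mem_algHull (A : IntegralRep 1)
    (hAd : A.domain = {t | t 0 ∈ Ioo (0:ℝ) 1})
    (hAi : EqOn A.integrand
      (fun t => (t 0) ^ (((1 / 3 : ℚ) : ℝ) - 1) * (1 - t 0) ^ (((2 / 3 : ℚ) : ℝ) - 1)) A.domain)
    {k : ℕ} (cs : Fin k → FormalPeriodRing)
    (hπ : toFormalPeriod (of KZ.piRep) ∈ soloInformedAlgHull cs) :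
    toFormalPeriod (of A) ∈ soloInformedAlgHull cs := by
  have h3 : Real.sqrt 3 ≠ 0 := by positivity
  have hinv : IsAlgebraic ℚ (Real.sqrt 3)⁻¹ := (soloInformed_isAlgebraic_sqrt_natCast 3).inv
  have hA : toFormalPeriod (of A) = toFormalPeriod (of (IntegralRep.unit.constMul
      (Real.sqrt 3)⁻¹ hinv)) * (2 * toFormalPeriod (of KZ.piRep)) := by
    rw [← soloInformed_reflection_third A hAd hAi, ← mul_assoc,
      soloInformed_pointRep_inv_mul _ _ h3 hinv, one_mul]
  rw [hA]
  exact mul_mem (soloInformed_pointRep_mem_algHull cs _ hinv) (mul_mem (ofNat_mem _ 2) hπ)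

/-! ### All 36 level-6 Beta classes lie in `K[⟦β(⅙,½)⟧, ⟦β(⅔,½)⟧]` -/

/-- **Every level-6 Beta class lies in the `K`-hull of the two generators `⟦β(⅙,½)⟧, ⟦β(⅔,½)⟧`.**
For pinned generators `B₁₃ = β(⅙,½)`, `B₄₃ = β(⅔,½)` with classes in a `K`-hull, and ANY pinned
`B = β(i/6, j/6)` with `1 ≤ i, j ≤ 6`, the class `⟦B⟧` lies in that hull.  The 36 cases, by the
kernel-checked chains: unit exponent (`i = 6` or `j = 6`), swap, duplication (`β(a,a)`), torsion
`W12` (`β(⅓,⅙)`), inversion (`β(⅙,⅔)`), the `3`-isogeny (`β(⅓,½)`), Euler (`π`), the reflections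
(`β(½,½) = π`, `β(⅙,⅚) = 2π`, `√3·β(⅓,⅔) = 2π`), and the second-kind chains W45, W25, W35
(`β(⅚,⅔), β(⅚,⅓), β(⅚,½)`, hence `β(⅚,⅚)`). [this work] -/
theorem soloInformed_betaLevelSix_mem_algHull (B₁₃ B₄₃ : IntegralRep 1)
    (h13d : B₁₃.domain = {t | t 0 ∈ Ioo (0:ℝ) 1})
    (h13i : EqOn B₁₃.integrand
      (fun t => (t 0) ^ (((1 / 6 : ℚ) : ℝ) - 1) * (1 - t 0) ^ (((1 / 2 : ℚ) : ℝ) - 1)) B₁₃.domain)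
    (h43d : B₄₃.domain = {t | t 0 ∈ Ioo (0:ℝ) 1})
    (h43i : EqOn B₄₃.integrand
      (fun t => (t 0) ^ (((2 / 3 : ℚ) : ℝ) - 1) * (1 - t 0) ^ (((1 / 2 : ℚ) : ℝ) - 1)) B₄₃.domain)
    {k : ℕ} (cs : Fin k → FormalPeriodRing) (h13 : toFormalPeriod (of B₁₃) ∈ soloInformedAlgHull cs)
    (h43 : toFormalPeriod (of B₄₃) ∈ soloInformedAlgHull cs)
    (i j : ℕ) (hi : 1 ≤ i) (hi' : i ≤ 6) (hj : 1 ≤ j) (hj' : j ≤ 6) (B : IntegralRep 1)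
    (hBd : B.domain = {t | t 0 ∈ Ioo (0:ℝ) 1})
    (hBi : EqOn B.integrand (fun t => (t 0) ^ (((((i : ℚ) / 6 : ℚ)) : ℝ) - 1) *
      (1 - t 0) ^ (((((j : ℚ) / 6 : ℚ)) : ℝ) - 1)) B.domain) :
    toFormalPeriod (of B) ∈ soloInformedAlgHull cs := by
  -- derived memberships: β(⅓,½), π, and the auxiliary pinned classes used through a swap
  obtain ⟨B₂₃, h23d, h23i⟩ := soloInformed_exists_betaRep (1 / 3) (1 / 2) (by norm_num) (by norm_num)
  have h23 := soloInformed_betaThirdHalf_mem_algHull B₂₃ B₁₃ h23d h23i h13d h13i cs h13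
  have hπ := soloInformed_piRep_mem_algHull B₁₃ B₄₃ h13d h13i h43d h43i cs h13 h43
  obtain ⟨T₂₁, h21d, h21i⟩ := soloInformed_exists_betaRep (1 / 3) (1 / 6) (by norm_num) (by norm_num)
  have h21 := soloInformed_betaThirdSixth_mem_algHull T₂₁ B₂₃ h21d h21i h23d h23i cs h23
  obtain ⟨T₁₄, h14d, h14i⟩ := soloInformed_exists_betaRep (1 / 6) (2 / 3) (by norm_num) (by norm_num)
  have h14 := soloInformed_betaSixthTwoThirds_mem_algHull T₁₄ B₂₃ h14d h14i h23d h23i cs h23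
  obtain ⟨T₁₅, h15d, h15i⟩ := soloInformed_exists_betaRep (1 / 6) (5 / 6) (by norm_num) (by norm_num)
  have h15 : toFormalPeriod (of T₁₅) ∈ soloInformedAlgHull cs := by
    rw [soloInformed_reflection_sixth T₁₅ h15d h15i]; exact mul_mem (ofNat_mem _ 2) hπ
  obtain ⟨T₂₄, h24d, h24i⟩ := soloInformed_exists_betaRep (1 / 3) (2 / 3) (by norm_num) (by norm_num)
  have h24 := soloInformed_betaThirdTwoThirds_mem_algHull T₂₄ h24d h24i cs hπ
  obtain ⟨T₅₄, h54d, h54i⟩ := soloInformed_exists_betaRep (5 / 6) (2 / 3) (by norm_num) (by norm_num)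
  have h54 := soloInformed_betaFiveSixthsTwoThirds_mem_algHull T₅₄ B₄₃ h54d h54i h43d h43i cs h43
  obtain ⟨T₅₂, h52d, h52i⟩ := soloInformed_exists_betaRep (5 / 6) (1 / 3) (by norm_num) (by norm_num)
  have h52 := soloInformed_betaFiveSixthsThird_mem_algHull T₅₂ B₄₃ h52d h52i h43d h43i cs h43
  obtain ⟨T₅₃, h53d, h53i⟩ := soloInformed_exists_betaRep (5 / 6) (1 / 2) (by norm_num) (by norm_num)
  have h53 := soloInformed_betaFiveSixthsHalf_mem_algHull T₅₃ B₄₃ h53d h53i h43d h43i cs h43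
  interval_cases i <;> interval_cases j
  -- i = 1 : β(⅙, j/6)
  · exact soloInformed_betaSymm_mem_algHull (1 / 6) B B₁₃ hBd
      (soloInformed_isBeta_congr hBi (by norm_num) (by norm_num)) h13d h13i cs h13
  · rw [soloInformed_beta_swap (1 / 6) (1 / 3) B T₂₁ hBd
      (soloInformed_isBeta_congr hBi (by norm_num) (by norm_num)) h21d h21i]
    exact h21
  · exact soloInformed_betaSixthHalf_mem_algHull B₂₃ B h23d h23i hBd
      (soloInformed_isBeta_congr hBi (by norm_num) (by norm_num)) cs h23
  · exact soloInformed_betaSixthTwoThirds_mem_algHull B B₂₃ hBd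
      (soloInformed_isBeta_congr hBi (by norm_num) (by norm_num)) h23d h23i cs h23
  · rw [soloInformed_reflection_sixth B hBd (soloInformed_isBeta_congr hBi (by norm_num) (by norm_num))]
    exact mul_mem (ofNat_mem _ 2) hπ
  · exact soloInformed_betaFirst_mem_algHull (1 / 6) (by norm_num) B hBd
      (soloInformed_isBeta_congr hBi (by norm_num) (by norm_num)) cs
  -- i = 2 : β(⅓, j/6)
  · exact soloInformed_betaThirdSixth_mem_algHull B B₂₃ hBd
      (soloInformed_isBeta_congr hBi (by norm_num) (by norm_num)) h23d h23i cs h23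
  · exact soloInformed_betaSymm_mem_algHull (1 / 3) B B₂₃ hBd
      (soloInformed_isBeta_congr hBi (by norm_num) (by norm_num)) h23d h23i cs h23
  · exact soloInformed_betaThirdHalf_mem_algHull B B₁₃ hBd
      (soloInformed_isBeta_congr hBi (by norm_num) (by norm_num)) h13d h13i cs h13
  · rw [soloInformed_beta_class_eq h24d h24i hBd
      (soloInformed_isBeta_congr hBi (by norm_num) (by norm_num))]
    exact h24
  · rw [soloInformed_beta_swap (1 / 3) (5 / 6) B T₅₂ hBd
      (soloInformed_isBeta_congr hBi (by norm_num) (by norm_num)) h52d h52i]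
    exact h52
  · exact soloInformed_betaFirst_mem_algHull (1 / 3) (by norm_num) B hBd
      (soloInformed_isBeta_congr hBi (by norm_num) (by norm_num)) cs
  -- i = 3 : β(½, j/6)
  · rw [soloInformed_beta_swap (1 / 2) (1 / 6) B B₁₃ hBd
      (soloInformed_isBeta_congr hBi (by norm_num) (by norm_num)) h13d h13i]
    exact h13
  · rw [soloInformed_beta_swap (1 / 2) (1 / 3) B B₂₃ hBd
      (soloInformed_isBeta_congr hBi (by norm_num) (by norm_num)) h23d h23i]
    exact h23
  · rw [← soloInformed_toFormalPeriod_piRep_eq_betaHalf B hBd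
      (soloInformed_isBeta_congr hBi (by norm_num) (by norm_num))]
    exact hπ
  · rw [soloInformed_beta_swap (1 / 2) (2 / 3) B B₄₃ hBd
      (soloInformed_isBeta_congr hBi (by norm_num) (by norm_num)) h43d h43i]
    exact h43
  · rw [soloInformed_beta_swap (1 / 2) (5 / 6) B T₅₃ hBd
      (soloInformed_isBeta_congr hBi (by norm_num) (by norm_num)) h53d h53i]
    exact h53
  · exact soloInformed_betaFirst_mem_algHull (1 / 2) (by norm_num) B hBd
      (soloInformed_isBeta_congr hBi (by norm_num) (by norm_num)) cs
  -- i = 4 : β(⅔, j/6)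
  · rw [soloInformed_beta_swap (2 / 3) (1 / 6) B T₁₄ hBd
      (soloInformed_isBeta_congr hBi (by norm_num) (by norm_num)) h14d h14i]
    exact h14
  · rw [soloInformed_beta_swap (2 / 3) (1 / 3) B T₂₄ hBd
      (soloInformed_isBeta_congr hBi (by norm_num) (by norm_num)) h24d h24i]
    exact h24
  · rw [soloInformed_beta_class_eq h43d h43i hBd
      (soloInformed_isBeta_congr hBi (by norm_num) (by norm_num))]
    exact h43
  · exact soloInformed_betaSymm_mem_algHull (2 / 3) B B₄₃ hBd
      (soloInformed_isBeta_congr hBi (by norm_num) (by norm_num)) h43d h43i cs h43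
  · rw [soloInformed_beta_swap (2 / 3) (5 / 6) B T₅₄ hBd
      (soloInformed_isBeta_congr hBi (by norm_num) (by norm_num)) h54d h54i]
    exact h54
  · exact soloInformed_betaFirst_mem_algHull (2 / 3) (by norm_num) B hBd
      (soloInformed_isBeta_congr hBi (by norm_num) (by norm_num)) cs
  -- i = 5 : β(⅚, j/6)
  · rw [soloInformed_beta_swap (5 / 6) (1 / 6) B T₁₅ hBd
      (soloInformed_isBeta_congr hBi (by norm_num) (by norm_num)) h15d h15i]
    exact h15
  · exact soloInformed_betaFiveSixthsThird_mem_algHull B B₄₃ hBd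
      (soloInformed_isBeta_congr hBi (by norm_num) (by norm_num)) h43d h43i cs h43
  · exact soloInformed_betaFiveSixthsHalf_mem_algHull B B₄₃ hBd
      (soloInformed_isBeta_congr hBi (by norm_num) (by norm_num)) h43d h43i cs h43
  · exact soloInformed_betaFiveSixthsTwoThirds_mem_algHull B B₄₃ hBd
      (soloInformed_isBeta_congr hBi (by norm_num) (by norm_num)) h43d h43i cs h43
  · exact soloInformed_betaFiveSixthsFiveSixths_mem_algHull B B₄₃ hBd
      (soloInformed_isBeta_congr hBi (by norm_num) (by norm_num)) h43d h43i cs h43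
  · exact soloInformed_betaFirst_mem_algHull (5 / 6) (by norm_num) B hBd
      (soloInformed_isBeta_congr hBi (by norm_num) (by norm_num)) cs
  -- i = 6 : β(1, j/6)
  · exact soloInformed_betaSecond_mem_algHull (1 / 6) (by norm_num) B hBd
      (soloInformed_isBeta_congr hBi (by norm_num) (by norm_num)) cs
  · exact soloInformed_betaSecond_mem_algHull (1 / 3) (by norm_num) B hBd
      (soloInformed_isBeta_congr hBi (by norm_num) (by norm_num)) cs
  · exact soloInformed_betaSecond_mem_algHull (1 / 2) (by norm_num) B hBd
      (soloInformed_isBeta_congr hBi (by norm_num) (by norm_num)) cs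
  · exact soloInformed_betaSecond_mem_algHull (2 / 3) (by norm_num) B hBd
      (soloInformed_isBeta_congr hBi (by norm_num) (by norm_num)) cs
  · exact soloInformed_betaSecond_mem_algHull (5 / 6) (by norm_num) B hBd
      (soloInformed_isBeta_congr hBi (by norm_num) (by norm_num)) cs
  · exact soloInformed_betaFirst_mem_algHull 1 one_pos B hBd
      (soloInformed_isBeta_congr hBi (by norm_num) (by norm_num)) cs

/-! ### The hull is decided -/

/-- **Independence of the generator values**: `B(⅙,½)` and `B(⅔,½)` are algebraically
independent over `ℚ` (Chudnovsky: `π, Γ(⅓)` independent — in the tree as Theorem IX″ for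
`![B(⅙,½), π]` — transported along Euler's `B(⅙,½)B(⅔,½) = 6π`). [Chudnovsky 1984, Ch. 7;
this work] -/
theorem soloInformed_algebraicIndependent_levelSix (B₁₃ B₄₃ : IntegralRep 1)
    (h13d : B₁₃.domain = {t | t 0 ∈ Ioo (0:ℝ) 1})
    (h13i : EqOn B₁₃.integrand
      (fun t => (t 0) ^ (((1 / 6 : ℚ) : ℝ) - 1) * (1 - t 0) ^ (((1 / 2 : ℚ) : ℝ) - 1)) B₁₃.domain)
    (h43d : B₄₃.domain = {t | t 0 ∈ Ioo (0:ℝ) 1})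
    (h43i : EqOn B₄₃.integrand
      (fun t => (t 0) ^ (((2 / 3 : ℚ) : ℝ) - 1) * (1 - t 0) ^ (((1 / 2 : ℚ) : ℝ) - 1)) B₄₃.domain) :
    AlgebraicIndependent ℚ ![B₁₃.value, B₄₃.value] :=
  soloInformed_algebraicIndependent_euler_pair 1 6 B₁₃ B₄₃ one_pos (by norm_num) h13d
    (fun t ht => by rw [h13i ht]; norm_num) h43d (fun t ht => by rw [h43i ht]; norm_num)
    (soloInformed_algebraicIndependent_betaSixthHalf_pi B₁₃ h13d h13i)

/-- **The hull `K[⟦β(⅙,½)⟧, ⟦β(⅔,½)⟧]` is decided**: `KZP` holds for every pair of representations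
(any dimensions) with classes in it — equal values ⇒ equivalent by the moves. [this work] -/
theorem soloInformed_kzp_on_hull_levelSix (B₁₃ B₄₃ : IntegralRep 1)
    (h13d : B₁₃.domain = {t | t 0 ∈ Ioo (0:ℝ) 1})
    (h13i : EqOn B₁₃.integrand
      (fun t => (t 0) ^ (((1 / 6 : ℚ) : ℝ) - 1) * (1 - t 0) ^ (((1 / 2 : ℚ) : ℝ) - 1)) B₁₃.domain)
    (h43d : B₄₃.domain = {t | t 0 ∈ Ioo (0:ℝ) 1})
    (h43i : EqOn B₄₃.integrand
      (fun t => (t 0) ^ (((2 / 3 : ℚ) : ℝ) - 1) * (1 - t 0) ^ (((1 / 2 : ℚ) : ℝ) - 1)) B₄₃.domain)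
    {n m : ℕ} (r : IntegralRep n) (r' : IntegralRep m)
    (hr : toFormalPeriod (of r) ∈
      soloInformedAlgHull ![toFormalPeriod (of B₁₃), toFormalPeriod (of B₄₃)])
    (hr' : toFormalPeriod (of r') ∈
      soloInformedAlgHull ![toFormalPeriod (of B₁₃), toFormalPeriod (of B₄₃)])
    (hv : r.value = r'.value) : Equivalent r r' := by
  refine soloInformed_kzp_on_algHull _ (soloInformed_algebraicIndependent_evalP_pair ?_)
    r r' hr hr' hv
  rw [evalP_toFormalPeriod_of, evalP_toFormalPeriod_of]
  exact soloInformed_algebraicIndependent_levelSix B₁₃ B₄₃ h13d h13i h43d h43i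

/-- **Level 6 vs the hull.** A pinned level-6 Beta representation `β(i/6, j/6)` is equivalent by
the moves to ANY representation (any dimension) of the same value whose class lies in
`K[⟦β(⅙,½)⟧, ⟦β(⅔,½)⟧]`. [this work] -/
theorem soloInformed_levelSix_decided (B₁₃ B₄₃ : IntegralRep 1)
    (h13d : B₁₃.domain = {t | t 0 ∈ Ioo (0:ℝ) 1})
    (h13i : EqOn B₁₃.integrand
      (fun t => (t 0) ^ (((1 / 6 : ℚ) : ℝ) - 1) * (1 - t 0) ^ (((1 / 2 : ℚ) : ℝ) - 1)) B₁₃.domain)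
    (h43d : B₄₃.domain = {t | t 0 ∈ Ioo (0:ℝ) 1})
    (h43i : EqOn B₄₃.integrand
      (fun t => (t 0) ^ (((2 / 3 : ℚ) : ℝ) - 1) * (1 - t 0) ^ (((1 / 2 : ℚ) : ℝ) - 1)) B₄₃.domain)
    (i j : ℕ) (hi : 1 ≤ i) (hi' : i ≤ 6) (hj : 1 ≤ j) (hj' : j ≤ 6) (B : IntegralRep 1)
    (hBd : B.domain = {t | t 0 ∈ Ioo (0:ℝ) 1})
    (hBi : EqOn B.integrand (fun t => (t 0) ^ (((((i : ℚ) / 6 : ℚ)) : ℝ) - 1) *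
      (1 - t 0) ^ (((((j : ℚ) / 6 : ℚ)) : ℝ) - 1)) B.domain)
    {m : ℕ} (r' : IntegralRep m)
    (hr' : toFormalPeriod (of r') ∈
      soloInformedAlgHull ![toFormalPeriod (of B₁₃), toFormalPeriod (of B₄₃)])
    (hv : B.value = r'.value) : Equivalent B r' :=
  soloInformed_kzp_on_hull_levelSix B₁₃ B₄₃ h13d h13i h43d h43i B r'
    (soloInformed_betaLevelSix_mem_algHull B₁₃ B₄₃ h13d h13i h43d h43i _
      (soloInformed_mem_algHull_self _ 0) (soloInformed_mem_algHull_self _ 1)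
      i j hi hi' hj hj' B hBd hBi) hr' hv

/-- **THE PERIOD CONJECTURE IS DECIDED AT LEVEL 6.** Two pinned level-6 Beta representations
`β(i/6, j/6)`, `β(i'/6, j'/6)` (`1 ≤ i, j, i', j' ≤ 6`) with the same value are equivalent by the
Kontsevich–Zagier moves — unconditionally (one transcendence input: Chudnovsky on `π, Γ(⅓)`;
everything else is chains of moves). [this work] -/
theorem soloInformed_kzp_betaLevelSix (i j i' j' : ℕ) (hi : 1 ≤ i) (hi₆ : i ≤ 6) (hj : 1 ≤ j)
    (hj₆ : j ≤ 6) (hi' : 1 ≤ i') (hi'₆ : i' ≤ 6) (hj' : 1 ≤ j') (hj'₆ : j' ≤ 6)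
    (B B' : IntegralRep 1)
    (hBd : B.domain = {t | t 0 ∈ Ioo (0:ℝ) 1})
    (hBi : EqOn B.integrand (fun t => (t 0) ^ (((((i : ℚ) / 6 : ℚ)) : ℝ) - 1) *
      (1 - t 0) ^ (((((j : ℚ) / 6 : ℚ)) : ℝ) - 1)) B.domain)
    (hB'd : B'.domain = {t | t 0 ∈ Ioo (0:ℝ) 1})
    (hB'i : EqOn B'.integrand (fun t => (t 0) ^ (((((i' : ℚ) / 6 : ℚ)) : ℝ) - 1) *
      (1 - t 0) ^ (((((j' : ℚ) / 6 : ℚ)) : ℝ) - 1)) B'.domain)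
    (hv : B.value = B'.value) : Equivalent B B' := by
  obtain ⟨B₁₃, h13d, h13i⟩ := soloInformed_exists_betaRep (1 / 6) (1 / 2) (by norm_num)
    (by norm_num)
  obtain ⟨B₄₃, h43d, h43i⟩ := soloInformed_exists_betaRep (2 / 3) (1 / 2) (by norm_num)
    (by norm_num)
  exact soloInformed_kzp_on_hull_levelSix B₁₃ B₄₃ h13d h13i h43d h43i B B'
    (soloInformed_betaLevelSix_mem_algHull B₁₃ B₄₃ h13d h13i h43d h43i _
      (soloInformed_mem_algHull_self _ 0) (soloInformed_mem_algHull_self _ 1)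
      i j hi hi₆ hj hj₆ B hBd hBi)
    (soloInformed_betaLevelSix_mem_algHull B₁₃ B₄₃ h13d h13i h43d h43i _
      (soloInformed_mem_algHull_self _ 0) (soloInformed_mem_algHull_self _ 1)
      i' j' hi' hi'₆ hj' hj'₆ B' hB'd hB'i) hv

end Summit.KontsevichZagierPeriods.KontsevichZagierPeriods.Theorems

end
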